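import Mathlib.Analysis.InnerProductSpace.PiL2
import Literature.Analysis.FunctionSpaces.TorusFluidGlueProofs
import Literature.Analysis.FunctionSpaces.TorusPlanarLift
import Literature.Analysis.FunctionSpaces.TorusCalculusProofs
import HarnessLib

/-!
# Stub `stub_axialMomentumTestIdentity` of the line `SketchIdeator2`
# (card `separatrix-flux-pinning`; crux stmt-AnomalousDissipation-14249,
# `MarginalStabilityChain.ChainRealisation`)

**Axial momentum tested against `x₂`-independent functions is pressure-free.**  Let `(u, p)` be a
classical solution of the forced incompressible Navier–Stokes system with viscosity `ν` on
`T³ × S` (`Torus.IsClassicalNSSolutionOn S ν f u p`), `S ⊆ ℝ` a convex time set, and let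
`ψ : T² → ℝ` be smooth, lifted to the `x₂`-independent test function `φ = ψ ∘ planarProj` on
`T³`.  Then for every `t ∈ S`, as a one-sided derivative within `S`,

`d/dt ∫ φ u₂ = ∫ u₂ (u₀ ∂₀φ + u₁ ∂₁φ) + ν ∫ u₂ Δφ + ∫ φ f₂`.

Proof (the printed computation behind every "multiply the momentum equation by a test function
and integrate by parts", e.g. Doering–Foias, J. Fluid Mech. 467 (2002), §2;
Robinson–Rodrigo–Sadowski, *The three-dimensional Navier–Stokes equations* (2016), §3.1):
differentiate under the integral over the compact torus within the convex time set
(`Torus.IsSmoothSpaceTimeOn.hasDerivWithinAt_integral`), `∂ₜ(φ u₂) = φ ∂ₜu₂`, and insert the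
third component of the momentum equation, `f₂ = ∂ₜu₂ + ((u·∇)u)₂ - ν (Δu)₂ + ∂₂p`.  Then

* the pressure term vanishes: `∫ φ ∂₂p = -∫ p ∂₂φ = 0` because `∂₂(ψ ∘ planarProj) = 0`
  (`Torus.partialDeriv_comp_planarProj_last`, `Torus.integral_inner_partialDeriv_eq_neg`);
* the viscous term is symmetric: `∫ φ (Δu)₂ = ∫ φ Δ(u₂) = ∫ u₂ Δφ` (components commute with
  the Laplacian; Green's second identity `Torus.integral_inner_laplacian_comm`);
* the convective term is antisymmetric for `div u = 0`:
  `∫ φ ((u·∇)u)₂ = ∫ φ (u·∇)u₂ = -∫ u₂ (u·∇)φ` (`Torus.integral_inner_convect_eq_neg`, Temam's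
  `b(u,v,w) = -b(u,w,v)`), and `(u·∇)φ = u₀∂₀φ + u₁∂₁φ` since `∂₂φ = 0`.

The statement is `AxialMomentumTestIdentity` of the line skeleton, written over tree vocabulary
with the skeleton's local notations `𝕋³`, `E³`, `𝕋²`, `E²` (verbatim registered stub signature);
this file supports the crux item without closing it.
-/

-- `Summit.<Summit>.<Problem>` is the tree's mandated summit-side namespace (CONVENTIONS §2); for
-- this single-conjunct summit the two coincide, so the duplicate is deliberate.
set_option linter.dupNamespace false

noncomputable section

open MeasureTheory Set Filter Topology
open scoped InnerProductSpace
open Literature.Analysis.FunctionSpaces Literature.Analysis.FunctionSpaces.Torus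

namespace Summit.AnomalousDissipation.AnomalousDissipation.Theorems.ChainRealisation
namespace SeparatrixFluxPinning

/-- Local notation: the torus `T³`. -/
local notation "𝕋³" => UnitAddTorus (Fin 3)
/-- Local notation: velocity values. -/
local notation "E³" => EuclideanSpace ℝ (Fin 3)
/-- Local notation: the planar torus `T²`. -/
local notation "𝕋²" => UnitAddTorus (Fin 2)
/-- Local notation: planar velocity values. -/
local notation "E²" => EuclideanSpace ℝ (Fin 2)

/-! ## Components of vector fields on `T³` commute with the torus differential operators -/

/-- Products of smooth real functions on the torus are smooth. [folklore] -/
theorem isSmooth_mul {a b : 𝕋³ → ℝ} (ha : IsSmooth a) (hb : IsSmooth b) :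
    IsSmooth (fun x => a x * b x) :=
  ha.smul' hb

/-- Components of the gradient are the partial derivatives: `(∇θ)ᵢ = ∂ᵢθ` for `C¹` scalar `θ`
(`⟪∇θ, eᵢ⟫ = Dθ[eᵢ]`). [folklore] -/
theorem gradient_apply_eq_partialDeriv {θ : 𝕋³ → ℝ} (hθ : IsContDiff 1 θ)
    (x : 𝕋³) (i : Fin 3) :
    gradient θ x i = partialDeriv i θ x := by
  have h1 : ⟪gradient θ x, EuclideanSpace.single i (1 : ℝ)⟫_ℝ = gradient θ x i := by
    rw [EuclideanSpace.inner_single_right]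
    simp
  rw [← h1, Torus.inner_gradient_left, partialDeriv_eq_fderiv_apply hθ]

/-- Components commute with the convective derivative: `((w·∇)v)ᵢ = (w·∇)vᵢ` for `C¹` fields
`v` (chain rule for the coordinate projection, a continuous linear map). [folklore] -/
theorem convect_apply_eq {w v : 𝕋³ → E³}
    (hv : IsContDiff 1 v) (i : Fin 3) (x : 𝕋³) :
    convect w v x i = convect w (fun y => v y i) x := by
  set L : E³ →L[ℝ] ℝ := EuclideanSpace.proj i
  have hd : DifferentiableAt ℝ (liftAt v x) 0 :=
    ((hv.liftAt x).differentiable one_ne_zero).differentiableAt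
  have hL : liftAt (fun y => v y i) x = L ∘ liftAt v x := by
    funext y; rfl
  change L (Torus.fderiv v x (w x)) = Torus.fderiv (fun y => v y i) x (w x)
  rw [Torus.fderiv, Torus.fderiv, hL,
    (L.hasFDerivAt.comp (0 : E³) hd.hasFDerivAt).fderiv]
  rfl

/-- Components commute with the Laplacian: `(Δv)ᵢ = Δ(vᵢ)` for smooth fields `v`
(`Δ = ∑ⱼ ∂ⱼ∂ⱼ` and `∂ⱼ (L ∘ v) = L ∘ ∂ⱼ v` for the coordinate projection `L`). [folklore] -/
theorem laplacian_apply_eq {v : 𝕋³ → E³}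
    (hv : IsSmooth v) (i : Fin 3) (x : 𝕋³) :
    laplacian v x i = laplacian (fun y => v y i) x := by
  -- adapted from `Torus.laplacian_clm_comp_apply` (TorusInverseLaplacianCalculus)
  set L : E³ →L[ℝ] ℝ := EuclideanSpace.proj i
  have hcomp : (fun y => v y i) = L ∘ v := by
    funext y; rfl
  have h1 : ∀ j, partialDeriv j (L ∘ v) = L ∘ partialDeriv j v :=
    fun j => funext (partialDeriv_clm_comp hv L j)
  change L (laplacian v x) = laplacian (fun y => v y i) x
  rw [hcomp, laplacian_eq_sum_partialDeriv_partialDeriv (hv.comp_clm L),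
    laplacian_eq_sum_partialDeriv_partialDeriv hv, map_sum]
  refine Finset.sum_congr rfl fun j _ => ?_
  rw [h1 j, partialDeriv_clm_comp (hv.partialDeriv j) L j x]

/-- The convective derivative of an `x₂`-independent test function only sees the planar
velocity: `(w·∇)(ψ ∘ planarProj) = w₀ ∂₀(ψ ∘ planarProj) + w₁ ∂₁(ψ ∘ planarProj)`. [folklore] -/
theorem convect_comp_planarProj_eq_sum (w : 𝕋³ → E³)
    {ψ : 𝕋² → ℝ} (hψ : IsSmooth ψ) (x : 𝕋³) :
    convect w (ψ ∘ planarProj) x =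
      ∑ j : Fin 2, w x (Fin.castSucc j) * partialDeriv (Fin.castSucc j) (ψ ∘ planarProj) x := by
  rw [convect, fderiv_apply_eq_sum_partialDeriv (hψ.comp_planarProj.isContDiff (by simp)),
    Fin.sum_univ_castSucc, partialDeriv_comp_planarProj_last]
  simp only [smul_eq_mul, Pi.zero_apply, mul_zero, add_zero]

/-! ## The identity -/

/-- **Axial momentum tested against `x₂`-independent functions is pressure-free**
(`AxialMomentumTestIdentity` of the line `SketchIdeator2`).  For a classical solution of the
forced Navier–Stokes system on `T³ × S`, `S` convex, and a smooth planar test function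
`ψ : T² → ℝ` lifted to `φ = ψ ∘ planarProj`, the tested axial momentum `s ↦ ∫ φ u₂(s)` has
one-sided derivative `∫ u₂ (u₀∂₀φ + u₁∂₁φ) + ν ∫ u₂ Δφ + ∫ φ f₂` within `S` at every `t ∈ S`:
differentiate under the integral, insert the third component of the momentum equation, and
integrate by parts on the torus — the pressure term `∫ φ ∂₂p = -∫ p ∂₂φ` vanishes because
`∂₂φ = 0`, the viscous term is Green-symmetric and the trilinear term is antisymmetric for
divergence-free `u` (Doering–Foias 2002, §2; Temam, *Navier–Stokes Equations*, Ch. II,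
Lemma 1.3).  At an isolated point of `S` the claim is vacuous. [folklore] -/
theorem stub_axialMomentumTestIdentity :
    ∀ {S : Set ℝ} {ν : ℝ} {f u : ℝ → 𝕋³ → E³} {p : ℝ → 𝕋³ → ℝ}
      (_h : IsClassicalNSSolutionOn S ν f u p) (_hS : Convex ℝ S) (ψ : 𝕋² → ℝ) (_hψ : IsSmooth ψ)
      {t : ℝ} (_ht : t ∈ S),
      HasDerivWithinAt (fun s => ∫ x, ψ (planarProj x) * u s x 2)
        ((∫ x, u t x 2 *
            ∑ j : Fin 2, u t x (Fin.castSucc j) * partialDeriv (Fin.castSucc j) (ψ ∘ planarProj) x) +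
          ν * (∫ x, u t x 2 * laplacian (ψ ∘ planarProj) x) +
          ∫ x, ψ (planarProj x) * f t x 2)
        S t := by
  intro S ν f u p h hS ψ hψ t ht
  by_cases hacc : AccPt t (𝓟 S)
  swap
  · exact HasFDerivWithinAt.of_not_accPt hacc
  have hU : UniqueDiffOn ℝ S :=
    uniqueDiffOn_convex hS (interior_nonempty_of_convex_of_accPt hS ht hacc)
  have hu : IsSmoothSpaceTimeOn S u := h.smooth_velocity
  have hut : IsSmooth (u t) := hu.isSmooth_slice ht
  have hpt : IsSmooth (p t) := h.smooth_pressure.isSmooth_slice ht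
  have hA : IsSmooth (timeDerivWithin S u t) := hu.isSmooth_timeDerivWithin hU ht
  have hφ : IsSmooth (ψ ∘ planarProj) := hψ.comp_planarProj
  have hu2 : IsSmooth (fun y => u t y 2) := hut.apply 2
  -- Step 1: differentiate under the integral sign, `d/dt ∫ φ u₂ = ∫ φ ∂ₜu₂`.
  have hg : IsSmoothSpaceTimeOn S (fun s x => ψ (planarProj x) * u s x 2) :=
    (isSmoothSpaceTimeOn_const hφ S).mul (hu.apply 2)
  have hE : HasDerivWithinAt (fun s => ∫ x, ψ (planarProj x) * u s x 2)
      (∫ x, timeDerivWithin S (fun s x => ψ (planarProj x) * u s x 2) t x) S t :=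
    hg.hasDerivWithinAt_integral hS ht
  have hslice : ∀ x, timeDerivWithin S (fun s x => ψ (planarProj x) * u s x 2) t x =
      ψ (planarProj x) * timeDerivWithin S u t x 2 := by
    intro x
    have h1 : HasDerivWithinAt (fun τ => u τ x 2) (timeDerivWithin S u t x 2) S t :=
      (EuclideanSpace.proj (2 : Fin 3) :
          E³ →L[ℝ] ℝ).hasFDerivAt.comp_hasDerivWithinAt t
        (hu.hasDerivWithinAt_slice ht x)
    exact (h1.const_mul (ψ (planarProj x))).derivWithin (hU t ht)
  have hE' : (fun x => timeDerivWithin S (fun s x => ψ (planarProj x) * u s x 2) t x) =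
      fun x => ψ (planarProj x) * timeDerivWithin S u t x 2 := funext hslice
  rw [hE'] at hE
  convert hE using 1
  -- Step 2: insert the third component of the momentum equation.
  have hf_eq : ∀ x, f t x = timeDerivWithin S u t x + convect (u t) (u t) x -
      ν • laplacian (u t) x + gradient (p t) x := by
    intro x
    rw [h.momentum t ht x]
    abel
  have hf2 : ∀ x, ψ (planarProj x) * f t x 2 =
      ψ (planarProj x) * timeDerivWithin S u t x 2 +
        ψ (planarProj x) * convect (u t) (u t) x 2 -
        ψ (planarProj x) * (ν * laplacian (u t) x 2) +
        ψ (planarProj x) * gradient (p t) x 2 := by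
    intro x
    rw [hf_eq x]
    simp only [PiLp.add_apply, PiLp.sub_apply, PiLp.smul_apply, smul_eq_mul]
    ring
  have iA : Integrable (fun x => ψ (planarProj x) * timeDerivWithin S u t x 2) volume :=
    (isSmooth_mul hφ (hA.apply 2)).integrable
  have iC : Integrable (fun x => ψ (planarProj x) * convect (u t) (u t) x 2) volume :=
    (isSmooth_mul hφ ((hut.convect hut).apply 2)).integrable
  have iL : Integrable (fun x => ψ (planarProj x) * (ν * laplacian (u t) x 2)) volume :=
    (isSmooth_mul hφ ((hut.laplacian.smul ν).apply 2)).integrable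
  have iG : Integrable (fun x => ψ (planarProj x) * gradient (p t) x 2) volume :=
    (isSmooth_mul hφ (hpt.gradient.apply 2)).integrable
  have hsplit : ∫ x, ψ (planarProj x) * f t x 2 =
      (∫ x, ψ (planarProj x) * timeDerivWithin S u t x 2) +
        (∫ x, ψ (planarProj x) * convect (u t) (u t) x 2) -
        (∫ x, ψ (planarProj x) * (ν * laplacian (u t) x 2)) +
        ∫ x, ψ (planarProj x) * gradient (p t) x 2 := by
    simp_rw [hf2]
    rw [integral_add ?_ iG, integral_sub ?_ iL, integral_add iA iC]
    · exact iA.add iC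
    · exact (iA.add iC).sub iL
  -- Step 3: the three integrations by parts on the torus.
  -- (a) pressure: `∫ φ ∂₂p = -∫ p ∂₂φ = 0`
  have hP : ∫ x, ψ (planarProj x) * gradient (p t) x 2 = 0 := by
    have h0 : partialDeriv (2 : Fin 3) (ψ ∘ planarProj) = 0 :=
      partialDeriv_comp_planarProj_last ψ
    have h1 := integral_inner_partialDeriv_eq_neg (G := ℝ) hpt hφ 2
    rw [h0] at h1
    simp only [Pi.zero_apply, inner_zero_right, integral_zero, neg_zero] at h1
    have h2 : (fun x => ψ (planarProj x) * gradient (p t) x 2) =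
        fun x => ⟪partialDeriv 2 (p t) x, (ψ ∘ planarProj) x⟫_ℝ := by
      funext x
      rw [Real.inner_apply, Function.comp_apply, mul_comm,
        gradient_apply_eq_partialDeriv (hpt.isContDiff (by simp))]
    rw [h2, h1]
  -- (b) viscosity: `∫ φ (Δu)₂ = ∫ u₂ Δφ`
  have hLap : ∫ x, ψ (planarProj x) * (ν * laplacian (u t) x 2) =
      ν * ∫ x, u t x 2 * laplacian (ψ ∘ planarProj) x := by
    have h1 := integral_inner_laplacian_comm (G := ℝ) hu2 hφ
    have h2 : (fun x => ψ (planarProj x) * (ν * laplacian (u t) x 2)) =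
        fun x => ν * ⟪laplacian (fun y => u t y 2) x, (ψ ∘ planarProj) x⟫_ℝ := by
      funext x
      rw [Real.inner_apply, Function.comp_apply, laplacian_apply_eq hut 2 x]
      ring
    have h3 : (fun x => ⟪u t x 2, laplacian (ψ ∘ planarProj) x⟫_ℝ) =
        fun x => u t x 2 * laplacian (ψ ∘ planarProj) x := by
      funext x
      rw [Real.inner_apply]
    rw [h2, integral_const_mul, h1, h3]
  -- (c) convection: `∫ φ ((u·∇)u)₂ = -∫ u₂ (u·∇)φ`, and `(u·∇)φ = u₀∂₀φ + u₁∂₁φ`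
  have hConv : ∫ x, ψ (planarProj x) * convect (u t) (u t) x 2 =
      -∫ x, u t x 2 * ∑ j : Fin 2, u t x (Fin.castSucc j) *
        partialDeriv (Fin.castSucc j) (ψ ∘ planarProj) x := by
    have h1 := integral_inner_convect_eq_neg (G := ℝ) hut (h.divFree t ht) hu2 hφ
    have h2 : (fun x => ψ (planarProj x) * convect (u t) (u t) x 2) =
        fun x => ⟪convect (u t) (fun y => u t y 2) x, (ψ ∘ planarProj) x⟫_ℝ := by
      funext x
      rw [Real.inner_apply, Function.comp_apply, convect_apply_eq (hut.isContDiff (by simp)) 2 x,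
        mul_comm]
    have h3 : (fun x => ⟪u t x 2, convect (u t) (ψ ∘ planarProj) x⟫_ℝ) =
        fun x => u t x 2 * ∑ j : Fin 2, u t x (Fin.castSucc j) *
          partialDeriv (Fin.castSucc j) (ψ ∘ planarProj) x := by
      funext x
      rw [Real.inner_apply, convect_comp_planarProj_eq_sum (u t) hψ x]
    rw [h2, h1, h3]
  rw [hsplit, hP, hLap, hConv]
  ring

end SeparatrixFluxPinning
end Summit.AnomalousDissipation.AnomalousDissipation.Theorems.ChainRealisation

end
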